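import Summits.BirchSwinnertonDyer.Rank1Residual.Supersingular.KuriharaTwistRecordGenericLValues
import Summits.BirchSwinnertonDyer.Rank1Residual.Supersingular.KuriharaTwistSymbolKuriharaK
import HarnessLib

/-!
# DEPTH-`k` (q = p^k) twist records: `kuriharaNumber f (p^k) n ψ ≠ 0` from a LANDED `CertifiedK` row, its rounding
# certificate with `p^k` bins, and the engine's enclosure of the twisted `L`-value combination — the level-`k` analogue
# of `CertifiedOddL.kuriharaNumber_ne_zero_of_LValueBall` (class-free)

Cell `b2b-bsdres`, supersingular family, prover A = unit `b2b-bsdres-x10b` (gen 13).  Topic file; namespace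
`Summit.BirchSwinnertonDyer.Rank1Residual.Supersingular.KuriharaTwist`.  THEOREMS + two small decidable predicates
(`RoundingCert.validHasseK`, `RoundingCertifiedHasseK` — the `p^k`-bin variants of gen 11's `validHasse` / `RoundingCertifiedHasse`;
same inequality, only the two length conjuncts change); no named fact, nothing asserted about any curve, nothing booked.

HONEST FRAMING (run/shared/lean/b2b/bsd-rank1-residual/, verbatim in every file): the goal of the
cell is to DELETE the COMBINATION-SHAPED residual classes of the Birch–Swinnerton-Dyer formula for
ALL analytic-rank `≤ 1` elliptic curves over `ℚ` — "full BSD formula for every rank `≤ 1` curve in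
class `C`" assembled STRICTLY from published theorems — so that the rank-`≤ 1` remainder becomes
exactly the CONSTRUCTION-SHAPED classes, which are TYPED (missing-input `Prop`s), NOT attempted.
This is not "finishing BSD".

## Why

Depth-`k` Kurihara numbers (`δ̃_n^{(k)} mod p^k`, `n ∈ 𝒩_k`) are now consumed in the tree — additive-p3's 16
`RankOneKimLevel9UnitRecords` (O4@3 / O3, `q = 9`, Kim 2025 OPEN) and this seat's N4 TAM-DEFECT record
`bsdp_x6r0tam_145146q1_5` (`q = 25`, Kim 2026 Thm 1.8 (6) + Perrin-Riou Prop 4.8, PUBLISHED) — but so far only through a DATUM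
binder `hδ : kuriharaNumber D.f (p^k) n ψ ≠ 0` cited to an engine table.  At depth 1 the cell's standard since gen 11/12 is
stronger: a LANDED `decide`d record + rounding certificate + the engine's ENCLOSURE claim `hballL` of the displayed twisted
`L`-value combination, the rounding to exact bins and the algebra to `δ̃` being kernel steps.  This file supplies the same chain
at depth `k`: the algebra is gen 10's `TwistRecordK.kuriharaNumber_eq_deltaMod_of_consistent` (sum-bins mod `p^k`, binomial
moments, structure congruences); Birch's formula + the DFT of the bins is gen 12's `plusPeriod_mul_binSum_eq` /
`ratCast_binSum_eq_re_div`, stated for ANY odd modulus `M`; the rounding soundness is gen 10/11's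
`RoundingCert.sum_ratPlusSymbol_eq_div_of_ineq` (Hasse-bounded denominators), which is per-bin and indifferent to their number.

## What this file proves

* §1 `RoundingCert.validHasseK k` / `RoundingCertifiedHasseK k` + unpacking lemmas (`validHasseK 1 = validHasse`).
* §2 `TwistRecordK.bins_eq_of_validHasseK_of_ball` — exact bins from the certificate + the symbol-ball enclosure.
* §3 `TwistRecordK.kuriharaNumber_ne_zero_of_nonvanishing_of_isNewformOf` — the Hecke relation, `A_ℓ ≡ 2 (mod p^k)` and
  `p`-integrality hypotheses of gen 10's theorem DISCHARGED from `IsNewformOf`, irreducibility at `p` and the depth-`k` Kolyvagin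
  condition `Kato.IsKolyvaginProduct W p k n` (exactly as gen 10 did at `k = 1`).
* §4 `TwistRecordK.bins_eq_of_validHasseK_of_LValueBall` and the class-free goal
  `CertifiedK.kuriharaNumber_ne_zero_of_LValueBall`: rows `r ∈ rs` (`CertifiedK`), `c ∈ cs` (`RoundingCertifiedHasseK r.k`),
  matching, + `f` the newform of `W`, `p ≠ 2`, irr(p), good(p), `n ∈ 𝒩_k`, surjective `ψ`, `hballL` ⟹ `kuriharaNumber f (p^k) n ψ ≠ 0`
  — plugging straight into the `hδ` binder of every depth-`k` consumer.
* §5 sanity (`decide`): the depth-2 rounding row of 254980d1 @ 73 (this seat's kit j148185) is `validHasseK 2`.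

References: [Kim2022StructureSelmer] §1.2.2, §1.4.3; [MazurTateTeitelbaum1986Invent] §I.8; [CremonaAlgorithms1997] §2.8; tree files
`KuriharaTwistSymbolKuriharaK.lean`, `KuriharaTwistSchemaLevelK.lean` (gen 10), `KuriharaTwistRoundingIntegrality/HasseCheck.lean`
(gen 10/11), `KuriharaTwistBirch.lean`, `KuriharaTwistRecordAssemblyLValues.lean`, `KuriharaTwistRecordGenericLValues.lean` (gen 12).
-/

set_option autoImplicit false

noncomputable section

open scoped Classical MatrixGroups ModularForm

open CongruenceSubgroup WeierstrassCurve Literature.NumberTheory.EllipticCurves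
  Literature.NumberTheory.EllipticCurves.ModularForms

namespace Summit.BirchSwinnertonDyer.Rank1Residual.Supersingular.KuriharaTwist

/-! ### §1 Rounding certificates with `p^k` bins -/

/-- Validity of a rounding certificate FOR `p^k` BINS in the Hasse-bounded currency: gen 11's `RoundingCert.validHasse` with
the bin count `c.p` replaced by `c.p ^ k` — `#bins = #binsStar = p^k`, `0 < D ∣ D'`, `J_j·D = (D·C_j)·D'` for every zipped
pair, and the cleared inequality `8·p·(marNum·10^radExp + radNum·10^marExp) < 10^(marExp + radExp)` (`p` = the good prime
`c.p`, whose Hasse bound controls the denominators). [cite: CremonaAlgorithms1997, §2.8 (2.8.8) (PDF p. 26)] -/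
def RoundingCert.validHasseK (c : RoundingCert) (k : ℕ) : Bool :=
  (c.bins.length == c.p ^ k) && (c.binsStar.length == c.p ^ k) && (0 < c.den) && (c.dstar % c.den == 0) &&
  ((c.bins.zip c.binsStar).all fun ij => ij.2 * (c.den : ℤ) == ij.1 * (c.dstar : ℤ)) &&
  (8 * c.p * (c.marNum * 10 ^ c.radExp + c.radNum * 10 ^ c.marExp) < 10 ^ (c.marExp + c.radExp))

/-- At `k = 1`, `validHasseK` is `validHasse`. [folklore] -/
theorem RoundingCert.validHasseK_one (c : RoundingCert) : c.validHasseK 1 = c.validHasse := by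
  simp only [RoundingCert.validHasseK, RoundingCert.validHasse, Nat.pow_one]

/-- A list of rounding certificates is `RoundingCertifiedHasseK k` when every one is `validHasseK k` (generated theorems
`certRK…` proved by `decide`). [folklore] -/
def RoundingCertifiedHasseK (k : ℕ) (cs : List RoundingCert) : Prop := cs.all (RoundingCert.validHasseK · k) = true

/-- `RoundingCertifiedHasseK k cs` is decidable (a `Bool` equation). [folklore] -/
instance RoundingCertifiedHasseK.instDecidable (k : ℕ) (cs : List RoundingCert) :
    Decidable (RoundingCertifiedHasseK k cs) :=
  inferInstanceAs (Decidable (cs.all (RoundingCert.validHasseK · k) = true))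

/-- Unpacking `RoundingCertifiedHasseK`: every listed certificate is `validHasseK k`. [folklore] -/
theorem RoundingCertifiedHasseK.validHasseK_of_mem {k : ℕ} {cs : List RoundingCert} (h : RoundingCertifiedHasseK k cs)
    {c : RoundingCert} (hc : c ∈ cs) : c.validHasseK k = true :=
  List.all_eq_true.1 h c hc

/-- `RoundingCertifiedHasseK` of a `cons`. [folklore] -/
theorem RoundingCertifiedHasseK.cons_iff (k : ℕ) (c : RoundingCert) (cs : List RoundingCert) :
    RoundingCertifiedHasseK k (c :: cs) ↔ c.validHasseK k = true ∧ RoundingCertifiedHasseK k cs := by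
  simp [RoundingCertifiedHasseK, List.all_cons]

/-- The empty list passes. [folklore] -/
theorem RoundingCertifiedHasseK.nil (k : ℕ) : RoundingCertifiedHasseK k [] := by
  simp [RoundingCertifiedHasseK]

/-- The inequality of a `validHasseK` certificate. [folklore] -/
theorem RoundingCert.ineq_of_validHasseK {c : RoundingCert} {k : ℕ} (h : c.validHasseK k = true) :
    8 * c.p * (c.marNum * 10 ^ c.radExp + c.radNum * 10 ^ c.marExp) < 10 ^ (c.marExp + c.radExp) := by
  simp only [RoundingCert.validHasseK, Bool.and_eq_true, decide_eq_true_eq] at h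
  exact h.2

/-- The rescaling identities `J_j · D = (D·C_j) · D'` of a `validHasseK` certificate. [folklore] -/
theorem RoundingCert.rescale_of_validHasseK {c : RoundingCert} {k : ℕ} (h : c.validHasseK k = true) :
    ∀ ij ∈ c.bins.zip c.binsStar, ij.2 * (c.den : ℤ) = ij.1 * (c.dstar : ℤ) := by
  simp only [RoundingCert.validHasseK, Bool.and_eq_true, decide_eq_true_eq, List.all_eq_true, beq_iff_eq] at h
  exact h.1.2

/-- The two list lengths of a `validHasseK` certificate. [folklore] -/
theorem RoundingCert.lengths_of_validHasseK {c : RoundingCert} {k : ℕ} (h : c.validHasseK k = true) :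
    c.bins.length = c.p ^ k ∧ c.binsStar.length = c.p ^ k := by
  simp only [RoundingCert.validHasseK, Bool.and_eq_true, decide_eq_true_eq, beq_iff_eq] at h
  exact ⟨h.1.1.1.1.1, h.1.1.1.1.2⟩

/-! ### §2 Exact bins from the certificate and the symbol-ball enclosure -/

variable {N : ℕ} [NeZero N] {f : CuspForm (Gamma0 N) 2}
  {W : WeierstrassCurve ℚ} [W.IsElliptic] [W.IsGloballyMinimal]

/-- **`hbins` at depth `k` FROM A ROUNDING CERTIFICATE + THE ENGINE'S ENCLOSURE** — gen 11's
`TwistRecord.bins_eq_of_validHasse_of_ball` with `p^k` bins: `r : TwistRecordK`, `c` passing `validHasseK r.k` and matching `r`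
(`p, n, den, bins`; `0 < D'`), `f` the newform of `W` with good reduction at `r.p`, `gcd(r.n, N) = 1`; IF for every `j < p^k` the
engine's ball contains `D'·c_∞·Σ_{m(a)=j}[a/n]⁺_f`, THEN `bins[j] = D·c_∞·Σ_{m(a)=j}[a/n]⁺_f` exactly.
[cite: CremonaAlgorithms1997, §2.8 (2.8.8) (PDF p. 26)] -/
theorem TwistRecordK.bins_eq_of_validHasseK_of_ball (r : TwistRecordK) {c : RoundingCert}
    (hc : c.validHasseK r.k = true) [Fact r.p.Prime] [NeZero r.n]
    (hcp : c.p = r.p) (hcn : c.n = r.n) (hcden : c.den = r.den) (hcbins : c.bins = r.bins)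
    (hD' : 0 < c.dstar) (hf : IsNewformOf W f) (hgood : W.HasGoodReductionAtPrime r.p)
    (hcop : Nat.Coprime r.n N) (ψ : (ℓ : ℕ) → (ZMod ℓ)ˣ →* Multiplicative (ZMod (r.p ^ r.k)))
    (hball : ∀ j < r.p ^ r.k, ∃ mid rad : ℝ, rad ≤ (c.radNum : ℝ) / 10 ^ c.radExp ∧
      |mid - ((c.binsStar.getD j 0 : ℤ) : ℝ)| ≤ (c.marNum : ℝ) / 10 ^ c.marExp ∧
      |(c.dstar : ℝ) * (((r.components : ℚ) *
        ∑ a ∈ (Finset.univ : Finset (ZMod r.n)ˣ).filter (fun a =>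
          (∑ ℓ ∈ r.n.primeFactors.attach, Multiplicative.toAdd
            (ψ ℓ.1 (ZMod.unitsMap (Nat.dvd_of_mem_primeFactors ℓ.2) a))).val = j),
          ratPlusSymbol f ((((a : ZMod r.n).val : ℕ) : ℚ) / (r.n : ℚ)) : ℚ) : ℝ) - mid| ≤ rad) :
    ∀ j < r.p ^ r.k, ((r.bins.getD j 0 : ℤ) : ℚ) = (r.den : ℚ) * (r.components : ℚ) *
      ∑ a ∈ (Finset.univ : Finset (ZMod r.n)ˣ).filter (fun a =>
        (∑ ℓ ∈ r.n.primeFactors.attach, Multiplicative.toAdd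
          (ψ ℓ.1 (ZMod.unitsMap (Nat.dvd_of_mem_primeFactors ℓ.2) a))).val = j),
        ratPlusSymbol f ((((a : ZMod r.n).val : ℕ) : ℚ) / (r.n : ℚ)) := by
  intro j hj
  haveI : Fact c.p.Prime := ⟨hcp ▸ (Fact.out : r.p.Prime)⟩
  set S : Finset (ZMod r.n)ˣ := (Finset.univ : Finset (ZMod r.n)ˣ).filter (fun a =>
      (∑ ℓ ∈ r.n.primeFactors.attach, Multiplicative.toAdd
        (ψ ℓ.1 (ZMod.unitsMap (Nat.dvd_of_mem_primeFactors ℓ.2) a))).val = j) with hS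
  obtain ⟨mid, rad, hrad, hmar, hb⟩ := hball j hj
  have hsum : ∑ a ∈ S, (((r.components : ℤ)) : ℚ) * ratPlusSymbol f (((((a : ZMod r.n).val : ℤ)) : ℚ) / (r.n : ℚ))
      = (r.components : ℚ) * ∑ a ∈ S, ratPlusSymbol f ((((a : ZMod r.n).val : ℕ) : ℚ) / (r.n : ℚ)) := by
    rw [Finset.mul_sum]
    refine Finset.sum_congr rfl fun a _ => ?_
    push_cast; ring
  have hgood' : W.HasGoodReductionAtPrime c.p := by
    have key : ∀ (q : ℕ) [Fact q.Prime], q = r.p → W.HasGoodReductionAtPrime q := by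
      intro q _ hq; subst hq; exact hgood
    exact key c.p hcp
  have hcop' : Nat.Coprime c.n N := by rw [hcn]; exact hcop
  have hball' : |(c.dstar : ℝ) * ((∑ a ∈ S, (((r.components : ℤ)) : ℚ) *
      ratPlusSymbol f (((((a : ZMod r.n).val : ℤ)) : ℚ) / (c.n : ℚ)) : ℚ) : ℝ) - mid| ≤ rad := by
    rw [hcn, hsum]; exact hb
  have hx := c.sum_ratPlusSymbol_eq_div_of_ineq (RoundingCert.ineq_of_validHasseK hc) hf hgood' hcop' S
    (fun _ => (r.components : ℤ)) (fun a => ((a : ZMod r.n).val : ℤ)) hD' hball' hrad hmar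
  rw [hcn, hsum] at hx
  obtain ⟨hlb, hls⟩ := RoundingCert.lengths_of_validHasseK hc
  have hmem : (c.bins.getD j 0, c.binsStar.getD j 0) ∈ c.bins.zip c.binsStar :=
    getD_mem_zip c.bins c.binsStar 0 0 (by rw [hlb, hcp]; exact hj) (by rw [hls, hcp]; exact hj)
  have hresc := RoundingCert.rescale_of_validHasseK hc _ hmem
  simp only at hresc
  rw [hcbins, hcden] at hresc
  have hD'q : (c.dstar : ℚ) ≠ 0 := by exact_mod_cast hD'.ne'
  rw [mul_assoc, hx]
  field_simp
  exact_mod_cast hresc.symm.trans (mul_comm _ _)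

/-! ### §3 The Hecke-side hypotheses of gen 10's depth-`k` theorem, discharged from the newform and the Kolyvagin binder -/

/-- **`δ̃_n^{(k)} ≠ 0` from a NON-VANISHING depth-`k` record whose bins are the true plus-symbol bins**, with the Hecke relation,
`A_ℓ ≡ 2 (mod p^k)` and `p`-integrality of gen 10's `TwistRecordK.kuriharaNumber_ne_zero_of_nonvanishing` DISCHARGED: `f` the newform
of `W` (`IsNewformOf`), `p ≠ 2`, `ρ̄_{E,p}` irreducible, and `n ∈ 𝒩_k(E, p)` (`Kato.IsKolyvaginProduct W p k n`: square-free, every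
`ℓ ∣ n` good with `a_ℓ ≡ ℓ + 1 ≡ 2 (mod p^k)`). [cite: Kim2022StructureSelmer, §1.2.2 (PDF p. 5) and §1.4.3 (PDF p. 7)] -/
theorem TwistRecordK.kuriharaNumber_ne_zero_of_nonvanishing_of_isNewformOf (r : TwistRecordK)
    (hnv : r.nonvanishing = true) [hp : Fact r.p.Prime] [NeZero r.n]
    (hν : r.n.primeFactors.card = r.primes.length)
    (hf : IsNewformOf W f) (hp2 : r.p ≠ 2) (hirr : W.HasIrreducibleModPGaloisRep r.p)
    (hn : Kato.IsKolyvaginProduct W r.p r.k r.n)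
    (ψ : (ℓ : ℕ) → (ZMod ℓ)ˣ →* Multiplicative (ZMod (r.p ^ r.k)))
    (hbins : ∀ j < r.p ^ r.k, ((r.bins.getD j 0 : ℤ) : ℚ) = (r.den : ℚ) * (r.components : ℚ) *
      ∑ a ∈ (Finset.univ : Finset (ZMod r.n)ˣ).filter (fun a =>
        (∑ ℓ ∈ r.n.primeFactors.attach, Multiplicative.toAdd
          (ψ ℓ.1 (ZMod.unitsMap (Nat.dvd_of_mem_primeFactors ℓ.2) a))).val = j),
        ratPlusSymbol f ((((a : ZMod r.n).val : ℕ) : ℚ) / (r.n : ℚ))) :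
    kuriharaNumber f (r.p ^ r.k) r.n ψ ≠ 0 := by
  have hgood : ∀ ℓ ∈ r.n.primeFactors, ∀ [Fact ℓ.Prime], W.HasGoodReductionAtPrime ℓ :=
    fun ℓ hℓ _ => hasGoodReductionAtPrime_of_not_dvd_conductorNorm W
      (hn.isKolyvaginPrime (Nat.prime_of_mem_primeFactors hℓ)
        (Nat.dvd_of_mem_primeFactors hℓ)).not_dvd_conductorNorm
  have hcop : Nat.Coprime r.n N := Nat.coprime_of_dvd fun ℓ hℓp hℓn hℓN => by
    haveI : Fact ℓ.Prime := ⟨hℓp⟩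
    have hmem : ℓ ∈ r.n.primeFactors := Nat.mem_primeFactors.mpr ⟨hℓp, hℓn, NeZero.ne r.n⟩
    exact not_dvd_level_of_isNewformOf hf (hgood ℓ hmem) hℓN
  refine r.kuriharaNumber_ne_zero_of_nonvanishing f hnv hn.squarefree hν (fun ℓ => W.frobeniusTrace ℓ)
    (fun ℓ hℓ x => ?_)
    (fun ℓ hℓ => Identity.frobeniusTrace_cast_eq_two r.k (hn.isKolyvaginPrime (Nat.prime_of_mem_primeFactors hℓ)
      (Nat.dvd_of_mem_primeFactors hℓ)))
    (fun d hd z => hf.norm_ratPlusSymbol_div_le_one hp2 hirr (hcop.coprime_dvd_left hd) z) ψ hbins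
  haveI : Fact ℓ.Prime := ⟨Nat.prime_of_mem_primeFactors hℓ⟩
  exact Identity.hecke_ratPlusSymbol_of_isNewformOf hf (hgood ℓ hℓ) x

/-! ### §4 Through twisted `L`-values -/

/-- **`hbins` at depth `k` from the certificate and the `L`-VALUE enclosure** — gen 12's `TwistRecord.bins_eq_of_validHasse_of_LValueBall`
with modulus `M = p^k` (odd): the symbol-bin of class `j` equals
`re(Π(a_ℓ−2)·L(E,1) + Σ_{i≠0} e_M(−ij)·τ(χ_i)·L_i(1)) / (M·Ω⁺_f)` for ANY family `L_i` of entire continuations of the `L(f, χ_i⁻¹, s)`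
(`ratCast_binSum_eq_re_div`), so an enclosure of that displayed quantity is an enclosure of the bin.
[cite: MazurTateTeitelbaum1986Invent, §I.8 (8.6)] [cite: CremonaAlgorithms1997, §2.8 (2.8.8) (PDF p. 26)] -/
theorem TwistRecordK.bins_eq_of_validHasseK_of_LValueBall (r : TwistRecordK) {c : RoundingCert}
    (hc : c.validHasseK r.k = true) [hp : Fact r.p.Prime] [NeZero r.n]
    (hcp : c.p = r.p) (hcn : c.n = r.n) (hcden : c.den = r.den) (hcbins : c.bins = r.bins)
    (hD' : 0 < c.dstar) (hf : IsNewformOf W f) (hgood : W.HasGoodReductionAtPrime r.p)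
    (hcop : Nat.Coprime r.n N) (hp2 : r.p ≠ 2) (hsq : Squarefree r.n)
    (hgoodn : ∀ ℓ ∈ r.n.primeFactors, ∀ [Fact ℓ.Prime], W.HasGoodReductionAtPrime ℓ)
    (ψ : (ℓ : ℕ) → (ZMod ℓ)ˣ →* Multiplicative (ZMod (r.p ^ r.k)))
    (hψ : ∀ ℓ ∈ r.n.primeFactors, Function.Surjective (ψ ℓ))
    (hballL : ∀ (L : ZMod (r.p ^ r.k) → ℂ → ℂ), (∀ j, j ≠ 0 → Differentiable ℂ (L j)) →
      (∀ j, j ≠ 0 → ∀ s : ℂ, 2 < s.re → L j s = twistedLSeries f (binChar r.n ψ j)⁻¹ s) →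
      ∀ k < r.p ^ r.k, ∃ mid rad : ℝ, rad ≤ (c.radNum : ℝ) / 10 ^ c.radExp ∧
        |mid - ((c.binsStar.getD k 0 : ℤ) : ℝ)| ≤ (c.marNum : ℝ) / 10 ^ c.marExp ∧
        |(c.dstar : ℝ) * ((r.components : ℝ) *
          (((∏ ℓ ∈ r.n.primeFactors, ((W.frobeniusTrace ℓ : ℂ) - 2)) * W.entireLFunction 1 +
            ∑ j ∈ (Finset.univ : Finset (ZMod (r.p ^ r.k))).erase 0,
              ZMod.stdAddChar (-(j * (k : ZMod (r.p ^ r.k)))) *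
                (gaussSum (binChar r.n ψ j) (ZMod.stdAddChar (N := r.n)) * L j 1)).re /
            ((r.p ^ r.k : ℕ) * plusPeriod f))) - mid| ≤ rad) :
    ∀ j < r.p ^ r.k, ((r.bins.getD j 0 : ℤ) : ℚ) = (r.den : ℚ) * (r.components : ℚ) *
      ∑ a ∈ (Finset.univ : Finset (ZMod r.n)ˣ).filter (fun a =>
        (∑ ℓ ∈ r.n.primeFactors.attach, Multiplicative.toAdd
          (ψ ℓ.1 (ZMod.unitsMap (Nat.dvd_of_mem_primeFactors ℓ.2) a))).val = j),
        ratPlusSymbol f ((((a : ZMod r.n).val : ℕ) : ℚ) / (r.n : ℚ)) := by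
  haveI : NeZero (r.p ^ r.k) := ⟨pow_ne_zero _ hp.out.ne_zero⟩
  have hodd : Odd (r.p ^ r.k) := (hp.out.odd_of_ne_two hp2).pow
  choose L hL using fun j : ZMod (r.p ^ r.k) =>
    exists_differentiable_eq_twistedLSeries_holds f (m := r.n) (binChar r.n ψ j)⁻¹
  refine r.bins_eq_of_validHasseK_of_ball hc hcp hcn hcden hcbins hD' hf hgood hcop ψ fun k hk => ?_
  obtain ⟨mid, rad, h1, h2, h3⟩ := hballL L (fun j _ => (hL j).1) (fun j _ => (hL j).2) k hk
  refine ⟨mid, rad, h1, h2, ?_⟩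
  rw [Rat.cast_mul, Rat.cast_natCast, filter_val_eq_filter_binLogHom r.n ψ hk,
    ratCast_binSum_eq_re_div hf hodd hsq hgoodn ψ hψ (k : ZMod (r.p ^ r.k)) L (fun j _ => (hL j).1)
      (fun j _ => (hL j).2)]
  push_cast at h3 ⊢
  exact h3

/-- **CLASS-FREE GOAL: `kuriharaNumber f (p^k) n ψ ≠ 0` FROM A LANDED `CertifiedK` ROW, ITS `validHasseK` ROUNDING CERTIFICATE AND
THE ENGINE'S `L`-VALUE ENCLOSURE** — the depth-`k` analogue of `CertifiedOddL.kuriharaNumber_ne_zero_of_LValueBall`: rows `r ∈ rs`,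
`c ∈ cs` of two `decide`d lists, matching (`p, n, den, bins`; `0 < D'`); `f` the newform of `W`; `p ≠ 2`, `ρ̄_{E,p}` irreducible, good
reduction at `p`; `n ∈ 𝒩_k(E,p)`; `ψ_ℓ` surjective for `ℓ ∣ n`; and `hballL`.  This is the `hδ` binder of every depth-`k` consumer
(`X6RankZero.bsdp_of_kimLower_of_prop48`, additive-p3's `…kim2025_OPEN…_of_kuriharaNumber_ne_zero…` shapes); the records stay
certificate VALUES; nothing booked. [cite: Kim2022StructureSelmer, §1.2.2 (PDF p. 5) and §1.4.3 (PDF p. 7)]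
[cite: MazurTateTeitelbaum1986Invent, §I.8 (8.6)] [cite: CremonaAlgorithms1997, §2.8 (2.8.8) (PDF p. 26)] -/
theorem CertifiedK.kuriharaNumber_ne_zero_of_LValueBall {rs : List TwistRecordK} (hrs : CertifiedK rs)
    {r : TwistRecordK} (hr : r ∈ rs) [Fact r.p.Prime] [NeZero r.n]
    (hν : r.n.primeFactors.card = r.primes.length)
    (hf : IsNewformOf W f) (hp2 : r.p ≠ 2) (hirr : W.HasIrreducibleModPGaloisRep r.p)
    (hgood : W.HasGoodReductionAtPrime r.p) (hn : Kato.IsKolyvaginProduct W r.p r.k r.n)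
    {cs : List RoundingCert} (hcs : RoundingCertifiedHasseK r.k cs) {c : RoundingCert} (hc : c ∈ cs)
    (hcp : c.p = r.p) (hcn : c.n = r.n) (hcden : c.den = r.den) (hcbins : c.bins = r.bins) (hD' : 0 < c.dstar)
    (ψ : (ℓ : ℕ) → (ZMod ℓ)ˣ →* Multiplicative (ZMod (r.p ^ r.k)))
    (hψ : ∀ ℓ ∈ r.n.primeFactors, Function.Surjective (ψ ℓ))
    (hballL : ∀ (L : ZMod (r.p ^ r.k) → ℂ → ℂ), (∀ j, j ≠ 0 → Differentiable ℂ (L j)) →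
      (∀ j, j ≠ 0 → ∀ s : ℂ, 2 < s.re → L j s = twistedLSeries f (binChar r.n ψ j)⁻¹ s) →
      ∀ k < r.p ^ r.k, ∃ mid rad : ℝ, rad ≤ (c.radNum : ℝ) / 10 ^ c.radExp ∧
        |mid - ((c.binsStar.getD k 0 : ℤ) : ℝ)| ≤ (c.marNum : ℝ) / 10 ^ c.marExp ∧
        |(c.dstar : ℝ) * ((r.components : ℝ) *
          (((∏ ℓ ∈ r.n.primeFactors, ((W.frobeniusTrace ℓ : ℂ) - 2)) * W.entireLFunction 1 +
            ∑ j ∈ (Finset.univ : Finset (ZMod (r.p ^ r.k))).erase 0,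
              ZMod.stdAddChar (-(j * (k : ZMod (r.p ^ r.k)))) *
                (gaussSum (binChar r.n ψ j) (ZMod.stdAddChar (N := r.n)) * L j 1)).re /
            ((r.p ^ r.k : ℕ) * plusPeriod f))) - mid| ≤ rad) :
    kuriharaNumber f (r.p ^ r.k) r.n ψ ≠ 0 := by
  have hgoodn : ∀ ℓ ∈ r.n.primeFactors, ∀ [Fact ℓ.Prime], W.HasGoodReductionAtPrime ℓ :=
    fun ℓ hℓ _ => hasGoodReductionAtPrime_of_not_dvd_conductorNorm W
      (hn.isKolyvaginPrime (Nat.prime_of_mem_primeFactors hℓ)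
        (Nat.dvd_of_mem_primeFactors hℓ)).not_dvd_conductorNorm
  have hcop : Nat.Coprime r.n N := Nat.coprime_of_dvd fun ℓ hℓp hℓn hℓN => by
    haveI : Fact ℓ.Prime := ⟨hℓp⟩
    exact not_dvd_level_of_isNewformOf hf (hgoodn ℓ (Nat.mem_primeFactors.mpr ⟨hℓp, hℓn, NeZero.ne r.n⟩)) hℓN
  exact r.kuriharaNumber_ne_zero_of_nonvanishing_of_isNewformOf (hrs.nonvanishing_of_mem hr) hν hf hp2 hirr hn ψ
    (r.bins_eq_of_validHasseK_of_LValueBall (hcs.validHasseK_of_mem hc) hcp hcn hcden hcbins hD' hf hgood hcop hp2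
      hn.squarefree hgoodn ψ hψ hballL)

/-! ### §5 Sanity (kernel `decide`) -/

/-- The depth-2 rounding row of `254980d1` @ `3`, prime level `73` (this seat's implementation 3d depth-2 run, kit j148185;
`q = 9` bins, `D = 1`, `D' = 4 = 2·#E(ℚ)_tors`, margin `≤ 8.64·10⁻²⁰`, radius `≤ 3.58·10⁻¹³`) is `validHasseK 2`:
`#bins = #binsStar = 9`, `J_j·1 = (C_j)·4`, `24·(8.64·10⁻²⁰ + 3.58·10⁻¹³) < 1`. [folklore] -/
theorem roundingCertifiedHasseK_sample : RoundingCertifiedHasseK 2 [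
  { label := "254980d1", p := 3, n := 73, den := 1, bins := [22, 32, 4, 0, -4, -32, -22, -10, 10], torsion := 2, manin := 1,
    optimality := 1, dstar := 4, binsStar := [88, 128, 16, 0, -16, -128, -88, -40, 40], marNum := 864, marExp := 22,
    radNum := 358, radExp := 15,
    evidence := ["impl3d depth-2 kit j148185 impl3d-kurtw-seg/2026-08-22-g13-v2k (x10b g13)", "delta mod 9 = 6 = engine K v1.3 j136942"] } ] := by
  decide

end Summit.BirchSwinnertonDyer.Rank1Residual.Supersingular.KuriharaTwist

end
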